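import Literature.NumberTheory.BeurlingPrimes.BDTowerStieltjes
import Literature.NumberTheory.BeurlingPrimes.BDTowerProduct
import Literature.NumberTheory.BeurlingPrimes.DMVTemplateMellin
import Mathlib.MeasureTheory.Integral.DominatedConvergence
import HarnessLib

/-!
# The Mellin identity of the Broucke–Debruyne tower template: `exp ∫₁^∞ f_Θ(v) v^{−s} dv = s/(s−1) · T(s)`

Topic `Literature/NumberTheory/BeurlingPrimes`, grouping namespace `BDTower` (objects `BDTowerTemplate.lean`, product
`BDTowerProduct.lean`, density `BDTowerPositivity.lean` / `BDTowerStieltjes.lean`). Everything in this file is PROVED.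

Broucke–Debruyne 2023 §6 (arXiv:2211.08716 p. 15): "is `log ζ(s)` the Mellin–Stieltjes transform of a positive
measure `dΠ`? As in Section (DMV example) we write `log G(s) = −∫₁^∞ g(u) u^{−s−1} du`. One finds after some
calculations `dΠ(u) = (1−u^{−1})/log u du − 2 Σ_k g(u^{1/ℓ_k}) u^{β−1} cos(γ_k log u)/ℓ_k du`." This is
Diamond–Montgomery–Vorhauer (18)/(32)/(33) with `β_k ≡ Θ`; the tree proves it for the DMV template in
`DMVTemplateMellin.lean` (`logZetaC_eq_integral`, `exp_logZetaC`), and this file repeats that computation for the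
sparse-height tower template:

* `log_factor_pair_eq` — `log G(ℓ_k(s−ρ_k)) + log G(ℓ_k(s−ρ̄_k)) = −∫₁^∞ 2 oscTerm k v · v^{−s} dv` (`Re s > Θ`;
  tree `DMV.log_G_mul_eq`, `DMV.cpow_add_cpow_conj`);
* `summable_integral_norm_oscIntegrand` — `Σ_k ∫₁^∞ ‖2 oscTerm k v · v^{−s}‖ dv ≤ Σ_k (2/ℓ_k) e^{−ℓ_k(σ−Θ)}/(σ−Θ) < ∞`;
* `exp_logZeta` — `exp(log(s/(s−1)) + Σ_k (log G + log G')) = s/(s−1) · towerProd s`;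
* `exp_integral_densCut` — **`exp ∫₁^∞ densCut(v) v^{−s} dv = s/(s−1) · towerProd(s)` for `Re s > 1`**
  (discharges STUB `stub_towerMellin` of the CappedTowerAboveHalf skeleton).

## References
* [BrouckeDebruyne2023] F. Broucke, G. Debruyne, Acta Arith. 207 (2023), §6 (read).
* [DiamondMontgomeryVorhauer2006] H. G. Diamond, H. L. Montgomery, U. M. A. Vorhauer, Math. Ann. 334 (2006), §5
  (18), (32)–(35) (the model computation; tree `DMVTemplateMellin.lean`).
-/

noncomputable section

open Complex Filter Topology Set MeasureTheory
open scoped ComplexConjugate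

namespace Literature.NumberTheory.BeurlingPrimes

namespace BDTower

variable {Θ : ℝ}

/-! ### One pair of factors -/

/-- **DMV (33) for the `k`-th pair**: for `Re s > Θ`,
`log G(ℓ_k(s−ρ_k)) + log G(ℓ_k(s−ρ̄_k)) = −∫₁^∞ 2·oscTerm k v · v^{−s} dv`. [cite: BrouckeDebruyne2023, §6] -/
theorem log_factor_pair_eq (hΘ1 : Θ < 1) (k : ℕ) {s : ℂ} (hs : Θ < s.re) :
    Complex.log (DMV.G ((scale Θ k : ℂ) * (s - zero Θ k))) +
        Complex.log (DMV.G ((scale Θ k : ℂ) * (s - conj (zero Θ k)))) =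
      -∫ v in Ioi (1 : ℝ), ((2 * oscTerm Θ k v : ℝ) : ℂ) * (v : ℂ) ^ (-s) := by
  have hℓ := scale_pos hΘ1 k
  have hρ : (zero Θ k).re < s.re := by simpa using hs
  have hρ' : (conj (zero Θ k)).re < s.re := by simpa using hs
  rw [DMV.Template.log_G_mul_eq hℓ hρ, DMV.Template.log_G_mul_eq hℓ hρ', ← neg_add, ← mul_add]
  congr 1
  have hi1 := DMV.Template.integrableOn_f_rpow_mul_cpow (ℓ := scale Θ k) (zero Θ k - s - 1) (by simp; linarith)
  have hi2 := DMV.Template.integrableOn_f_rpow_mul_cpow (ℓ := scale Θ k) (conj (zero Θ k) - s - 1) (by simp; linarith)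
  rw [← integral_add hi1 hi2, ← MeasureTheory.integral_const_mul]
  refine setIntegral_congr_fun measurableSet_Ioi fun v hv ↦ ?_
  have hv0 : (0 : ℝ) < v := lt_trans one_pos hv
  rw [← mul_add, show zero Θ k = ⟨Θ, height k⟩ from rfl, DMV.cpow_add_cpow_conj hv0]
  unfold oscTerm
  push_cast
  field_simp

/-! ### The oscillating integrands and their summability -/

/-- The `k`-th summand `2 oscTerm k v · v^{−s}`. [cite: BrouckeDebruyne2023, §6] -/
def oscIntegrand (Θ : ℝ) (s : ℂ) (k : ℕ) (v : ℝ) : ℂ := ((2 * oscTerm Θ k v : ℝ) : ℂ) * (v : ℂ) ^ (-s)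

/-- Norm bound: for `v > 1`, `‖F k v‖ ≤ 1_{[e^{ℓ_k},∞)}(v) · (2/ℓ_k) v^{Θ−1−σ}`. [cite: BrouckeDebruyne2023, §6] -/
theorem norm_oscIntegrand_le (hΘ1 : Θ < 1) (s : ℂ) (k : ℕ) {v : ℝ} (hv : 1 < v) :
    ‖oscIntegrand Θ s k v‖ ≤
      (Ici (Real.exp (scale Θ k))).indicator (fun v ↦ 2 / scale Θ k * v ^ (Θ - 1 - s.re)) v := by
  have hv0 : 0 < v := by linarith
  by_cases h : v ∈ Ici (Real.exp (scale Θ k))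
  · rw [indicator_of_mem h, oscIntegrand, norm_mul, Complex.norm_real, norm_cpow_eq_rpow_re_of_pos hv0,
      Real.norm_eq_abs, abs_mul, abs_two, neg_re, Real.rpow_sub hv0, Real.rpow_neg hv0.le, div_eq_mul_inv]
    have h1 := abs_oscTerm_le hΘ1 k hv0.le
    have h2 : 0 ≤ (v ^ s.re)⁻¹ := by positivity
    calc 2 * |oscTerm Θ k v| * (v ^ s.re)⁻¹ ≤ 2 * (v ^ (Θ - 1) / scale Θ k) * (v ^ s.re)⁻¹ := by gcongr
      _ = 2 * (scale Θ k)⁻¹ * (v ^ (Θ - 1) * (v ^ s.re)⁻¹) := by ring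
  · rw [indicator_of_notMem h]
    rw [mem_Ici, not_le] at h
    rw [oscIntegrand, oscTerm_eq_zero_of_lt hΘ1 hv0.le h]
    simp

/-- `F k` is integrable on `(1,∞)` for `Re s > 1`. [cite: BrouckeDebruyne2023, §6] -/
theorem integrableOn_oscIntegrand (hΘ1 : Θ < 1) {s : ℂ} (hs : 1 < s.re) (k : ℕ) :
    IntegrableOn (oscIntegrand Θ s k) (Ioi 1) := by
  have hmeas : AEStronglyMeasurable (oscIntegrand Θ s k) (volume.restrict (Ioi 1)) := by
    refine (Measurable.mul ?_ ?_).aestronglyMeasurable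
    · exact Complex.measurable_ofReal.comp ((measurable_oscTerm Θ k).const_mul 2)
    · exact (Complex.measurable_ofReal.comp measurable_id).pow_const _
  have hq : Θ - 1 - s.re < -1 := by linarith
  have hmaj : IntegrableOn (fun v : ℝ ↦ 2 / scale Θ k * v ^ (Θ - 1 - s.re)) (Ioi 1) :=
    (integrableOn_Ioi_rpow_of_lt hq one_pos).const_mul _
  refine Integrable.mono' hmaj hmeas ?_
  rw [ae_restrict_iff' measurableSet_Ioi]
  refine Eventually.of_forall fun v hv ↦ (norm_oscIntegrand_le hΘ1 s k hv).trans ?_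
  have hv0 : (0 : ℝ) < v := lt_trans one_pos hv
  have hℓ := scale_pos hΘ1 k
  exact Set.indicator_apply_le' (fun _ ↦ le_rfl) (fun _ ↦ by positivity)

/-- `∫₁^∞ ‖F k‖ ≤ (2/(ℓ_0(σ−Θ))) e^{−ℓ_k(σ−Θ)}` for `Re s = σ > 1 > Θ`. [cite: BrouckeDebruyne2023, §6] -/
theorem integral_norm_oscIntegrand_le (hΘ1 : Θ < 1) {s : ℂ} (hs : 1 < s.re) (k : ℕ) :
    ∫ v in Ioi (1 : ℝ), ‖oscIntegrand Θ s k v‖ ≤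
      2 / (scale Θ 0 * (s.re - Θ)) * Real.exp (-(scale Θ k * (s.re - Θ))) := by
  have hℓ := scale_pos hΘ1 k
  have hℓ0 := scale_pos hΘ1 0
  have hℓ0k := scale_zero_le hΘ1 k
  set c : ℝ := Real.exp (scale Θ k) with hc
  have hc1 : 1 < c := by rw [hc, ← Real.exp_zero]; exact Real.exp_lt_exp.mpr hℓ
  have hc0 : 0 < c := lt_trans one_pos hc1
  set q : ℝ := Θ - 1 - s.re with hq
  have hq1 : q < -1 := by rw [hq]; linarith
  have hmaj_int : IntegrableOn (fun v : ℝ ↦ 2 / scale Θ k * v ^ q) (Ioi 1) :=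
    (integrableOn_Ioi_rpow_of_lt hq1 one_pos).const_mul _
  have hind_int : IntegrableOn ((Ici c).indicator fun v : ℝ ↦ 2 / scale Θ k * v ^ q) (Ioi 1) :=
    hmaj_int.indicator measurableSet_Ici
  have h1 : ∫ v in Ioi (1 : ℝ), ‖oscIntegrand Θ s k v‖ ≤
      ∫ v in Ioi (1 : ℝ), (Ici c).indicator (fun v : ℝ ↦ 2 / scale Θ k * v ^ q) v := by
    refine setIntegral_mono_on (integrableOn_oscIntegrand hΘ1 hs k).norm hind_int measurableSet_Ioi ?_
    intro v hv
    exact norm_oscIntegrand_le hΘ1 s k hv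
  have h2 : ∫ v in Ioi (1 : ℝ), (Ici c).indicator (fun v : ℝ ↦ 2 / scale Θ k * v ^ q) v =
      2 / scale Θ k * (c ^ (q + 1) / (-(q + 1))) := by
    rw [setIntegral_indicator measurableSet_Ici, Set.inter_eq_right.mpr (Ici_subset_Ioi.mpr hc1),
      integral_Ici_eq_integral_Ioi, MeasureTheory.integral_const_mul, integral_Ioi_rpow_of_lt hq1 hc0,
      neg_div, div_neg]
  rw [h2] at h1
  refine h1.trans ?_
  have hq2 : -(q + 1) = s.re - Θ := by rw [hq]; ring
  have hσΘ : 0 < s.re - Θ := by linarith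
  have hcq : c ^ (q + 1) = Real.exp (-(scale Θ k * (s.re - Θ))) := by
    rw [hc, ← Real.exp_mul]; congr 1; rw [hq]; ring
  rw [hq2, hcq]
  have hpos : 0 ≤ Real.exp (-(scale Θ k * (s.re - Θ))) := (Real.exp_pos _).le
  calc 2 / scale Θ k * (Real.exp (-(scale Θ k * (s.re - Θ))) / (s.re - Θ))
      ≤ 2 / scale Θ 0 * (Real.exp (-(scale Θ k * (s.re - Θ))) / (s.re - Θ)) := by gcongr
    _ = 2 / (scale Θ 0 * (s.re - Θ)) * Real.exp (-(scale Θ k * (s.re - Θ))) := by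
        field_simp

/-- `Σ_k ∫₁^∞ ‖F k‖ < ∞` for `Re s > 1` (a geometric series `Σ_k e^{−α(k+8)(σ−Θ)}`). [cite: BrouckeDebruyne2023, §6] -/
theorem summable_integral_norm_oscIntegrand (hΘ1 : Θ < 1) {s : ℂ} (hs : 1 < s.re) :
    Summable fun k ↦ ∫ v in Ioi (1 : ℝ), ‖oscIntegrand Θ s k v‖ := by
  have hα := slope_pos hΘ1
  have hσΘ : 0 < s.re - Θ := by linarith
  set r : ℝ := Real.exp (-(slope Θ * (s.re - Θ))) with hr
  have hr0 : 0 ≤ r := (Real.exp_pos _).le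
  have hr1 : r < 1 := Real.exp_lt_one_iff.mpr (by rw [neg_lt_zero]; positivity)
  have hgeom : Summable fun k : ℕ ↦ Real.exp (-(8 * slope Θ * (s.re - Θ))) * r ^ k :=
    (summable_geometric_of_lt_one hr0 hr1).mul_left _
  have heq : ∀ k : ℕ, Real.exp (-(scale Θ k * (s.re - Θ))) = Real.exp (-(8 * slope Θ * (s.re - Θ))) * r ^ k := by
    intro k
    rw [hr, ← Real.exp_nat_mul, ← Real.exp_add, scale]
    congr 1; ring
  refine Summable.of_nonneg_of_le (fun k ↦ integral_nonneg fun v ↦ norm_nonneg _)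
    (integral_norm_oscIntegrand_le hΘ1 hs) ?_
  simp_rw [heq]
  exact hgeom.mul_left _

/-! ### `log ζ` of the continuous system and its exponential -/

/-- `Σ_k ‖G(ℓ_k(s−ρ_k)) − 1‖ < ∞` and the same with `ρ̄_k`, at every `s`. [cite: BrouckeDebruyne2023, §6] -/
theorem summable_G_sub_one (hΘ1 : Θ < 1) (s : ℂ) :
    Summable (fun k ↦ DMV.G ((scale Θ k : ℂ) * (s - zero Θ k)) - 1) ∧
      Summable (fun k ↦ DMV.G ((scale Θ k : ℂ) * (s - conj (zero Θ k))) - 1) := by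
  set R : ℝ := |s.re - Θ| with hR
  have hRle : |s.re - Θ| ≤ R := le_rfl
  have hev : ∀ᶠ k in atTop, |s.im| ≤ height k / 2 := by
    have ht : Tendsto (fun k ↦ height k / 2) atTop atTop :=
      (Real.tendsto_exp_atTop.comp (tendsto_pow_atTop_atTop_of_one_lt (by norm_num : (1 : ℝ) < 4))).atTop_div_const
        (by norm_num)
    exact ht.eventually_ge_atTop _
  have hsum := summable_eps hΘ1 R
  constructor
  · refine Summable.of_norm_bounded_eventually_nat hsum ?_
    filter_upwards [hev] with k hk
    exact norm_G_scale_sub_one_le hΘ1 k (zero_re Θ k) (by rw [zero_im, abs_of_pos (height_pos k)]) hRle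
      (by rw [abs_sub_comm, abs_of_nonneg (by linarith [abs_nonneg s.im])]; linarith)
  · refine Summable.of_norm_bounded_eventually_nat hsum ?_
    filter_upwards [hev] with k hk
    exact norm_G_scale_sub_one_le hΘ1 k (by rw [Complex.conj_re, zero_re])
      (by rw [Complex.conj_im, zero_im, abs_neg, abs_of_pos (height_pos k)]) hRle
      (by rw [abs_sub_comm, abs_of_nonneg (by linarith [abs_nonneg s.im])]; linarith)

/-- `log ζ_c(s) = log(s/(s−1)) + Σ_k [log G(ℓ_k(s−ρ_k)) + log G(ℓ_k(s−ρ̄_k))]` (principal logarithms).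
[cite: BrouckeDebruyne2023, §6] -/
def logZeta (Θ : ℝ) (s : ℂ) : ℂ :=
  Complex.log (s / (s - 1)) +
    ∑' k, (Complex.log (DMV.G ((scale Θ k : ℂ) * (s - zero Θ k))) +
      Complex.log (DMV.G ((scale Θ k : ℂ) * (s - conj (zero Θ k)))))

/-- The `k`-sum in `logZeta` is summable. [cite: BrouckeDebruyne2023, §6] -/
theorem summable_log_G (hΘ1 : Θ < 1) (s : ℂ) :
    Summable fun k ↦ Complex.log (DMV.G ((scale Θ k : ℂ) * (s - zero Θ k))) +
      Complex.log (DMV.G ((scale Θ k : ℂ) * (s - conj (zero Θ k)))) := by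
  obtain ⟨h1, h2⟩ := summable_G_sub_one hΘ1 s
  have e1 : ∀ k, Complex.log (DMV.G ((scale Θ k : ℂ) * (s - zero Θ k))) =
      Complex.log (1 + (DMV.G ((scale Θ k : ℂ) * (s - zero Θ k)) - 1)) := fun k ↦ by rw [add_sub_cancel]
  have e2 : ∀ k, Complex.log (DMV.G ((scale Θ k : ℂ) * (s - conj (zero Θ k)))) =
      Complex.log (1 + (DMV.G ((scale Θ k : ℂ) * (s - conj (zero Θ k))) - 1)) := fun k ↦ by rw [add_sub_cancel]
  simp_rw [e1, e2]
  exact (Complex.summable_log_one_add_of_summable h1).add (Complex.summable_log_one_add_of_summable h2)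

/-- **`exp(logZeta s) = s/(s−1) · towerProd s`** for `Re s > Θ`, `s ≠ 0, 1`… we use `Re s > 1`.
[cite: BrouckeDebruyne2023, §6] -/
theorem exp_logZeta (hΘ : 1 / 2 < Θ) (hΘ1 : Θ < 1) {s : ℂ} (hs : 1 < s.re) :
    Complex.exp (logZeta Θ s) = s / (s - 1) * towerProd Θ s := by
  have hs0 : s ≠ 0 := fun h ↦ by rw [h] at hs; simp at hs; linarith
  have hs1 : s - 1 ≠ 0 := fun h ↦ by
    have : s = 1 := sub_eq_zero.mp h
    rw [this] at hs; simp at hs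
  rw [logZeta, Complex.exp_add, Complex.exp_log (div_ne_zero hs0 hs1)]
  congr 1
  have hsum := (summable_log_G hΘ1 s).hasSum
  have hprod := hsum.cexp
  have hre : ∀ (k : ℕ) (w : ℂ), w.re = Θ → 0 < ((scale Θ k : ℂ) * (s - w)).re := by
    intro k w hw
    simp only [mul_re, ofReal_re, ofReal_im, zero_mul, sub_zero, sub_re, hw]
    exact mul_pos (scale_pos hΘ1 k) (by linarith)
  have hfac : ∀ k, Complex.exp (Complex.log (DMV.G ((scale Θ k : ℂ) * (s - zero Θ k))) +
      Complex.log (DMV.G ((scale Θ k : ℂ) * (s - conj (zero Θ k))))) = factor Θ k s := by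
    intro k
    rw [Complex.exp_add, Complex.exp_log (DMV.G_ne_zero_of_re_pos (hre k _ (zero_re Θ k))),
      Complex.exp_log (DMV.G_ne_zero_of_re_pos (hre k _ (by rw [Complex.conj_re, zero_re]))), factor]
  have hfun : (Complex.exp ∘ fun k ↦ Complex.log (DMV.G ((scale Θ k : ℂ) * (s - zero Θ k))) +
      Complex.log (DMV.G ((scale Θ k : ℂ) * (s - conj (zero Θ k))))) = fun k ↦ factor Θ k s := funext hfac
  rw [hfun] at hprod
  rw [towerProd, hprod.tprod_eq]

/-! ### The Mellin identity -/

/-- The summed oscillating part `(poleDensity − densCut)(v) v^{−s} = 2(Σ_k oscTerm k v) v^{−s}` on `(1,∞)` is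
integrable for `Re s > 1` (it is bounded by `v^{−σ}/2`). [cite: BrouckeDebruyne2023, §6] -/
theorem integrableOn_oscPart (hΘ : 1 / 2 < Θ) (hΘ1 : Θ < 1) {s : ℂ} (hs : 1 < s.re) :
    IntegrableOn (fun v : ℝ ↦ ((DMV.poleDensity v - densCut Θ v : ℝ) : ℂ) * (v : ℂ) ^ (-s)) (Ioi 1) := by
  have hpole : Measurable DMV.poleDensity := by
    unfold DMV.poleDensity
    exact (measurable_const.sub (measurable_const.div measurable_id)).div Real.measurable_log
  have hmeas : AEStronglyMeasurable (fun v : ℝ ↦ ((DMV.poleDensity v - densCut Θ v : ℝ) : ℂ) * (v : ℂ) ^ (-s))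
      (volume.restrict (Ioi 1)) := by
    refine (Measurable.mul ?_ ?_).aestronglyMeasurable
    · exact Complex.measurable_ofReal.comp (hpole.sub (measurable_densCut hΘ1))
    · exact (Complex.measurable_ofReal.comp measurable_id).pow_const _
  refine Integrable.mono' ((integrableOn_Ioi_rpow_of_lt (show -s.re < -1 by linarith) one_pos).const_mul 1) hmeas ?_
  rw [ae_restrict_iff' measurableSet_Ioi]
  refine Eventually.of_forall fun v hv ↦ ?_
  have hv1 : (1 : ℝ) < v := hv
  have hv0 : (0 : ℝ) < v := lt_trans one_pos hv1
  rw [norm_mul, Complex.norm_real, Real.norm_eq_abs, norm_cpow_eq_rpow_re_of_pos hv0, neg_re]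
  have hb := primeDensity_bounds hΘ hΘ1 hv1
  have hp1 := DMV.Template.poleDensity_le_one hv1
  have hp0 := DMV.poleDensity_nonneg hv1
  rw [densCut_of_one_lt hv1]
  have habs : |DMV.poleDensity v - primeDensity Θ v| ≤ 1 := by
    rw [abs_le]; constructor <;> linarith
  have hr : 0 ≤ v ^ (-s.re) := (Real.rpow_pos_of_pos hv0 _).le
  calc |DMV.poleDensity v - primeDensity Θ v| * v ^ (-s.re) ≤ 1 * v ^ (-s.re) := by gcongr
    _ = 1 * v ^ (-s.re) := rfl

/-- **`∫₁^∞ densCut(v) v^{−s} dv = logZeta s`** for `Re s > 1` (DMV (18) for the tower template).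
[cite: BrouckeDebruyne2023, §6] -/
theorem integral_densCut_mul_cpow (hΘ : 1 / 2 < Θ) (hΘ1 : Θ < 1) {s : ℂ} (hs : 1 < s.re) :
    ∫ v in Ioi (1 : ℝ), (densCut Θ v : ℂ) * (v : ℂ) ^ (-s) = logZeta Θ s := by
  have hpole := DMV.log_div_sub_one_eq_integral hs
  have hterm : ∀ k, ∫ v in Ioi (1 : ℝ), oscIntegrand Θ s k v =
      -(Complex.log (DMV.G ((scale Θ k : ℂ) * (s - zero Θ k))) +
        Complex.log (DMV.G ((scale Θ k : ℂ) * (s - conj (zero Θ k))))) := by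
    intro k
    rw [log_factor_pair_eq hΘ1 k (by linarith), neg_neg]
    rfl
  have hex := integral_tsum_of_summable_integral_norm (μ := volume.restrict (Ioi (1 : ℝ)))
    (integrableOn_oscIntegrand hΘ1 hs) (summable_integral_norm_oscIntegrand hΘ1 hs)
  -- pointwise on `(1,∞)`: `Σ_k F k v = (poleDensity − densCut)(v) v^{−s}`
  have hpt : ∀ v ∈ Ioi (1 : ℝ), ∑' k, oscIntegrand Θ s k v =
      ((DMV.poleDensity v - densCut Θ v : ℝ) : ℂ) * (v : ℂ) ^ (-s) := by
    intro v hv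
    have hv1 : (1 : ℝ) < v := hv
    have hv0 : (0 : ℝ) < v := lt_trans one_pos hv1
    simp only [oscIntegrand]
    rw [tsum_mul_right]
    congr 1
    rw [densCut_of_one_lt hv1, primeDensity, show DMV.poleDensity v - (DMV.poleDensity v - 2 * ∑' k, oscTerm Θ k v)
      = 2 * ∑' k, oscTerm Θ k v by ring, Complex.ofReal_mul, Complex.ofReal_tsum]
    push_cast
    rw [tsum_mul_left]
  have hsum : ∑' k, (Complex.log (DMV.G ((scale Θ k : ℂ) * (s - zero Θ k))) +
      Complex.log (DMV.G ((scale Θ k : ℂ) * (s - conj (zero Θ k))))) =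
      -∫ v in Ioi (1 : ℝ), ((DMV.poleDensity v - densCut Θ v : ℝ) : ℂ) * (v : ℂ) ^ (-s) := by
    rw [← setIntegral_congr_fun measurableSet_Ioi hpt, ← hex, ← tsum_neg]
    refine tsum_congr fun k ↦ ?_
    rw [hterm k, neg_neg]
  rw [logZeta, hpole, hsum, ← sub_eq_add_neg,
    ← integral_sub (DMV.Template.integrableOn_poleDensity_mul_cpow hs) (integrableOn_oscPart hΘ hΘ1 hs)]
  refine setIntegral_congr_fun measurableSet_Ioi fun v _ ↦ ?_
  push_cast
  ring

/-- **The Mellin identity** (BD §6 / DMV (18)): for `1/2 < Θ < 1` and `Re s > 1`,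
`exp ∫₁^∞ densCut(v) v^{−s} dv = s/(s−1) · towerProd(s)`. [cite: BrouckeDebruyne2023, §6] -/
theorem exp_integral_densCut (hΘ : 1 / 2 < Θ) (hΘ1 : Θ < 1) {s : ℂ} (hs : 1 < s.re) :
    Complex.exp (∫ v in Ioi (1 : ℝ), (densCut Θ v : ℂ) * (v : ℂ) ^ (-s)) = s / (s - 1) * towerProd Θ s := by
  rw [integral_densCut_mul_cpow hΘ hΘ1 hs, exp_logZeta hΘ hΘ1 hs]

end BDTower

end Literature.NumberTheory.BeurlingPrimes

end
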